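import Mathlib
import HarnessLib
import Literature.MathematicalPhysics.StatisticalMechanics.RenormalisationMapActivityABKM
import Literature.MathematicalPhysics.StatisticalMechanics.RenormalisationMapLipschitzQ

/-!
# `S_k^{(q)}` on the `r`-ball and as a map into the admissible activities, for step data with a kernel BY
# PREDICATE ([ABKM19] Theorem 6.8, `q ∈ B_κ`)

`RenormalisationMapBallABKM` and `RenormalisationMapActivityABKM` were landed for the step kernel EQUAL to the weight kernel `𝒞_{k+1}` (`q = 0`).  Of the kernel their proofs
use only the facts recorded in `StepKernelBounds` (`StepKernelBoundsABKM`) and `C₂ ≤ h²`.  This file is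
the `q`-twin for step data with `StepKernelBounds W L k A𝒫' C₂ D.𝒞` relative to the `q = 0` weights
(constant `A_𝒫 ↦ A𝒫'`, including inside `largePartEps`/`gainConst`/`sigmaABKM`; `C₂ ≤ h²` in place of the
regularity-constant hypothesis):

* **`weakNormLE_nextKStep_sub_abkm_ball_of_stepKernelBounds`**, **`weakNormLE_nextKStep_abkm_ball_of_stepKernelBounds`**;
* `contDiff_nextKStep_abkm_of_stepKernelBounds`, `transInv_nextKStep_abkm_of_stepKernelBounds`,
  **`restrictConn_nextKStep_mem_activitySpace_of_stepKernelBounds`**.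

The `q = 0` statements are recovered with `AbkmWeightBounds.stepKernelBounds`.  Everything is proved;
no named fact.

## References
* S. Adams, S. Buchholz, R. Kotecký, S. Müller, arXiv:1910.13564, Theorem 6.8 ((6.59)–(6.60)),
  Lemmas 10.1–10.6, Lemma 7.7 [AdamsBuchholzKoteckyMuller2019].
-/

noncomputable section

namespace Literature.MathematicalPhysics.StatisticalMechanics.GradientRG

open scoped BigOperators Classical
open Finset MeasureTheory
open Literature.MathematicalPhysics.StatisticalMechanics.TorusPolymer
  (IsPolymer blocks polys bprod blockOf thicken reblock boxCorner mem_polys mem_blocks numBlocks isPolymer_blockOf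
    card_blocks_eq_numBlocks blocks_blockOf empty_mem_polys closure mem_blockOf_self)
open Literature.Barriers.CriticalPhenomena.LongRangePhi4.Polymer (IsConn components)
open Literature.MathematicalPhysics.StatisticalMechanics.GradientFRD (iterDiff)
open Literature.MathematicalPhysics.QuantumFieldTheory

variable {d M : ℕ} [NeZero M]

set_option maxHeartbeats 400000 in
/-- **`‖S(H,K) − S(H',K')‖_{k+1}^{(A)} ≤ σ(r)·max(‖H−H'‖_{k,0}, C_Δ)` on the `r`-ball** (module docstring):
`‖H‖_{k,0}, ‖H'‖_{k,0} ≤ r ≤ 1/64`, `‖K‖_k, ‖K'‖_k ≤ r`, `‖K − K'‖_k ≤ C_Δ ≤ 2r`, and the four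
conditions `v_r ≤ 1/64`, `ω(r)A² ≤ 1`, `κ(r)^{L^d}c₃ ≤ A^{η−1}`, `κ(r)^{L^d}c₂ ≤ A^{η−1}`.
[cite: AdamsBuchholzKoteckyMuller2019, Theorem 6.8 / Ch. 12 (12.4)] -/
theorem weakNormLE_nextKStep_sub_abkm_ball_of_stepKernelBounds {L N Mord R n p r₀ : ℕ} {θbar lam μ δ₁ δ₀ A𝒫 A𝒫' C₂ h A : ℝ}
    {𝒞 : ℕ → (Fin d → ZMod M) → ℝ} (hd : 3 ≤ d) (hLodd : Odd L) (hL : 2 ^ (d + 3) + 16 * R ≤ L)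
    (hR2 : 2 ≤ R) (hM : M = L ^ N) {k : ℕ} (hkN : k + 1 ≤ N)
    (hp : d / 2 + 2 ≤ p) (hpM : p + d ≤ Mord) (hMR : Mord ≤ R) (hr₀ : 3 ≤ r₀)
   
    (hB : AbkmWeightBounds L N Mord R n θbar lam μ δ₁ δ₀ A𝒫 𝒞
      (abkmWeightData L N Mord R θbar (schedDelta δ₀ δ₁ N) 𝒞))
    (hδ₀ : 0 < δ₀) (hδ₁ : 0 < δ₁) (hh : 0 < h) (hh0 : hZeroSq d R δ₀ δ₁ ≤ h ^ 2)
   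
    (hh2 : C₂ ≤ h ^ 2) (hA𝒫 : 0 ≤ A𝒫') (hA1 : 1 ≤ A)
    (hA𝒫A : A𝒫' ≤ A)
    (hsmall : (2 : ℝ) ^ (L ^ d) * (A𝒫' * A ^ (-(1 - (1 + 1 / ((2 * (2 ^ d + 1) + 6 : ℝ) ^ d))⁻¹) : ℝ)) ≤ 1)
    (D : StepData d M) (hDs : D.s = L ^ k) (hDL : D.L = L) (hS : StepKernelBounds (abkmWeightData L N Mord R θbar (schedDelta δ₀ δ₁ N) 𝒞) L k A𝒫' C₂ D.𝒞)
    {x₀ : Fin d → ZMod M} (hB₀ : D.B₀ = blockOf (L ^ k) x₀) (hc₀ : D.c₀ = boxCorner (L ^ k) (starRad R L d k) x₀)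
    {H H' : RelevantHamiltonian ℂ d} {r : ℝ}
    (hH : hamNorm (fieldWt h (L : ℝ) d k) ((L : ℝ) ^ k) (L ^ (d * k)) H ≤ r) (hH' : hamNorm (fieldWt h (L : ℝ) d k) ((L : ℝ) ^ k) (L ^ (d * k)) H' ≤ r) (hr : r ≤ 1 / 64)
    {K K' : Finset (Fin d → ZMod M) → ((Fin d → ZMod M) → ℝ) → ℂ} {CΔ : ℝ} (hCΔ : 0 ≤ CΔ)
    (hK : WeakNormLE (abkmNormParams L N Mord R p r₀ h θbar A (schedDelta δ₀ δ₁ N) 𝒞) k K r) (hK' : WeakNormLE (abkmNormParams L N Mord R p r₀ h θbar A (schedDelta δ₀ δ₁ N) 𝒞) k K' r)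
    (hΔ : WeakNormLE (abkmNormParams L N Mord R p r₀ h θbar A (schedDelta δ₀ δ₁ N) 𝒞) k (K - K') CΔ) (hCΔ2 : CΔ ≤ 2 * r)
    (hKfac : Factorises (L ^ k) K) (hK0 : ∀ φ, K ∅ φ = 1) (hK'fac : Factorises (L ^ k) K') (hK'0 : ∀ φ, K' ∅ φ = 1)
    (hKd : ∀ Y, ContDiff ℝ r₀ (K Y)) (hK'd : ∀ Y, ContDiff ℝ r₀ (K' Y))
    (hKloc : ∀ Y, IsPolymer (L ^ k) Y → IsConn Y → IsGaugeLocal ((abkmNormParams L N Mord R p r₀ h θbar A (schedDelta δ₀ δ₁ N) 𝒞).gauge k Y) (K Y))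
    (hK'loc : ∀ Y, IsPolymer (L ^ k) Y → IsConn Y → IsGaugeLocal ((abkmNormParams L N Mord R p r₀ h θbar A (schedDelta δ₀ δ₁ N) 𝒞).gauge k Y) (K' Y))
    (hKt : TransInv (L ^ k) K) (hK't : TransInv (L ^ k) K')
    (hv : vABKM d R A A𝒫' r ≤ 1 / 64) (hωA : omegaABKM d R A A𝒫' r * A ^ 2 ≤ 1)
    (hc3A : (kappaABKM d R A A𝒫' r) ^ (L ^ d) * ((2 * (2 * (kappaABKM d R A A𝒫' r) * max 1 A𝒫')) ^ ((2 ^ (d + 1) + 2) ^ d * L ^ d) * (4 : ℝ) ^ ((2 ^ (d + 1) + 2) ^ d * L ^ d)) ≤ A ^ ((1 + 1 / ((2 * (2 ^ d + 1) + 6 : ℝ) ^ d)) - 1 : ℝ))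
    (hc2A : (kappaABKM d R A A𝒫' r) ^ (L ^ d) * ((2 * (kappaABKM d R A A𝒫' r) * max 1 A𝒫') ^ ((2 ^ (d + 1) + 2) ^ d * L ^ d) * (2 : ℝ) ^ ((2 ^ (d + 1) + 2) ^ d * L ^ d)) ≤ A ^ ((1 + 1 / ((2 * (2 ^ d + 1) + 6 : ℝ) ^ d)) - 1 : ℝ)) :
    WeakNormLE (abkmNormParams L N Mord R p r₀ h θbar A (schedDelta δ₀ δ₁ N) 𝒞) (k + 1) (fun U φ => nextKStep D H K U φ - nextKStep D H' K' U φ)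
      (sigmaABKM d L R A A𝒫' r * max (hamNorm (fieldWt h (L : ℝ) d k) ((L : ℝ) ^ k) (L ^ (d * k)) (H - H')) CΔ) := by
  have hL0 : (0 : ℝ) < L := by exact_mod_cast hLodd.pos
  have hA0 : 0 < A := by linarith
  have h𝔥 : 0 < fieldWt h (L : ℝ) d k := fieldWt_pos hh hL0 d k
  have hRk : (0 : ℝ) < (L : ℝ) ^ k := by positivity
  have hnn : ∀ G : RelevantHamiltonian ℂ d, 0 ≤ hamNorm (fieldWt h (L : ℝ) d k) ((L : ℝ) ^ k) (L ^ (d * k)) G := fun G => hamNorm_nonneg h𝔥.le hRk.le _ _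
  have hr0 : 0 ≤ r := (hnn H).trans hH
  have hC87_0 : 0 ≤ pi2BoundConst d (((2 * R + 2 : ℕ) : ℝ) + ((d / 2 + 1 : ℕ) : ℝ)) := pi2BoundConst_nonneg d (by positivity)
  have hAinv : 0 ≤ A⁻¹ := inv_nonneg.2 hA0.le
  have hv0 : 0 ≤ pi2BoundConst d (((2 * R + 2 : ℕ) : ℝ) + ((d / 2 + 1 : ℕ) : ℝ)) * (r * A𝒫' * A⁻¹) := by positivity
  have he14 : 1 ≤ Real.exp (1 / 4) := Real.one_le_exp (by norm_num)
  have he38 : 0 ≤ 16 * Real.exp (3 / 8) := by positivity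
  -- `‖H − H'‖ ≤ 2r`
  have hx : hamNorm (fieldWt h (L : ℝ) d k) ((L : ℝ) ^ k) (L ^ (d * k)) (H - H') ≤ 2 * r := by
    have e := hamNorm_add_le h𝔥.le hRk.le (L ^ (d * k)) H (-H')
    rw [← sub_eq_add_neg, hamNorm_neg] at e
    linarith [e, hH, hH']
  have hx0 := hnn (H - H')
  -- `v_Δ ≤ 2 v_r`
  have hvΔ : pi2BoundConst d (((2 * R + 2 : ℕ) : ℝ) + ((d / 2 + 1 : ℕ) : ℝ)) * (CΔ * A𝒫' * A⁻¹) ≤ 2 * (pi2BoundConst d (((2 * R + 2 : ℕ) : ℝ) + ((d / 2 + 1 : ℕ) : ℝ)) * (r * A𝒫' * A⁻¹)) := by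
    have e := mul_le_mul_of_nonneg_left (mul_le_mul_of_nonneg_right (mul_le_mul_of_nonneg_right hCΔ2 hA𝒫) hAinv) hC87_0
    calc pi2BoundConst d (((2 * R + 2 : ℕ) : ℝ) + ((d / 2 + 1 : ℕ) : ℝ)) * (CΔ * A𝒫' * A⁻¹) ≤ pi2BoundConst d (((2 * R + 2 : ℕ) : ℝ) + ((d / 2 + 1 : ℕ) : ℝ)) * (2 * r * A𝒫' * A⁻¹) := e
      _ = 2 * (pi2BoundConst d (((2 * R + 2 : ℕ) : ℝ) + ((d / 2 + 1 : ℕ) : ℝ)) * (r * A𝒫' * A⁻¹)) := by ring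
  have hv' : pi2BoundConst d (((2 * R + 2 : ℕ) : ℝ) + ((d / 2 + 1 : ℕ) : ℝ)) * (r * A𝒫' * A⁻¹) ≤ 1 / 64 := hv
  have e1 : 2 * hamNorm (fieldWt h (L : ℝ) d k) ((L : ℝ) ^ k) (L ^ (d * k)) (H - H') + pi2BoundConst d (((2 * R + 2 : ℕ) : ℝ) + ((d / 2 + 1 : ℕ) : ℝ)) * (CΔ * A𝒫' * A⁻¹) ≤ 4 * r + 2 * (pi2BoundConst d (((2 * R + 2 : ℕ) : ℝ) + ((d / 2 + 1 : ℕ) : ℝ)) * (r * A𝒫' * A⁻¹)) := by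
    linarith [hx, hvΔ]
  have e2 := mul_le_mul_of_nonneg_left e1 he38
  have e3 : 2 * r + pi2BoundConst d (((2 * R + 2 : ℕ) : ℝ) + ((d / 2 + 1 : ℕ) : ℝ)) * (r * A𝒫' * A⁻¹) ≤ 4 * r + 2 * (pi2BoundConst d (((2 * R + 2 : ℕ) : ℝ) + ((d / 2 + 1 : ℕ) : ℝ)) * (r * A𝒫' * A⁻¹)) := by linarith [hr0, hv0]
  have e4 := mul_le_mul_of_nonneg_left e3 he38
  have e5 := mul_le_mul_of_nonneg_left hx he38
  have e6 : 16 * r ≤ 8 * Real.exp (1 / 4) * (2 * r + pi2BoundConst d (((2 * R + 2 : ℕ) : ℝ) + ((d / 2 + 1 : ℕ) : ℝ)) * (r * A𝒫' * A⁻¹)) := by nlinarith [he14, hr0, hv0]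
  have hω1 : 8 * Real.exp (1 / 4) * (2 * r + pi2BoundConst d (((2 * R + 2 : ℕ) : ℝ) + ((d / 2 + 1 : ℕ) : ℝ)) * (r * A𝒫' * A⁻¹)) + 16 * Real.exp (3 / 8) * (2 * hamNorm (fieldWt h (L : ℝ) d k) ((L : ℝ) ^ k) (L ^ (d * k)) (H - H') + pi2BoundConst d (((2 * R + 2 : ℕ) : ℝ) + ((d / 2 + 1 : ℕ) : ℝ)) * (CΔ * A𝒫' * A⁻¹)) ≤ omegaABKM d R A A𝒫' r := by
    unfold omegaABKM vABKM; linarith [e2]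
  have hω2 : 8 * Real.exp (1 / 4) * r + 16 * Real.exp (3 / 8) * hamNorm (fieldWt h (L : ℝ) d k) ((L : ℝ) ^ k) (L ^ (d * k)) (H - H') ≤ omegaABKM d R A A𝒫' r := by
    unfold omegaABKM vABKM
    have e7 : 8 * Real.exp (1 / 4) * r ≤ 8 * Real.exp (1 / 4) * (2 * r + pi2BoundConst d (((2 * R + 2 : ℕ) : ℝ) + ((d / 2 + 1 : ℕ) : ℝ)) * (r * A𝒫' * A⁻¹)) := by nlinarith [he14, hr0, hv0]
    nlinarith [e5, e7, he38, hr0, hv0]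
  have hω3 : r + CΔ ≤ omegaABKM d R A A𝒫' r := by
    unfold omegaABKM vABKM
    nlinarith [e6, hCΔ2, hr0, hv0, he38]
  have hκ1 : 1 + Real.exp (1 / 4) + 16 * Real.exp (3 / 8) * (2 * hamNorm (fieldWt h (L : ℝ) d k) ((L : ℝ) ^ k) (L ^ (d * k)) (H - H') + pi2BoundConst d (((2 * R + 2 : ℕ) : ℝ) + ((d / 2 + 1 : ℕ) : ℝ)) * (CΔ * A𝒫' * A⁻¹)) ≤ kappaABKM d R A A𝒫' r := by
    unfold kappaABKM vABKM; linarith [e2]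
  have hκ2 : 1 + Real.exp (1 / 4) + 16 * Real.exp (3 / 8) * (2 * r + pi2BoundConst d (((2 * R + 2 : ℕ) : ℝ) + ((d / 2 + 1 : ℕ) : ℝ)) * (r * A𝒫' * A⁻¹)) ≤ kappaABKM d R A A𝒫' r := by
    unfold kappaABKM vABKM; linarith [e4]
  exact weakNormLE_nextKStep_sub_abkm_max_gain_of_stepKernelBounds hd hLodd hL hR2 hM hkN hp hpM hMR hr₀ hB hδ₀ hδ₁ hh hh0
    hh2 hA𝒫 hA1 hA𝒫A hsmall D hDs hDL hS hB₀ hc₀ hH hH' hr hr0 hCΔ hK hK' hΔ hKfac hK0 hK'fac hK'0 hKd hK'd hKloc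
    hK'loc hKt hK't hv' hω1 hω2 hω3 hωA hκ1 hκ2 hc3A hc2A hCΔ2

set_option maxHeartbeats 400000 in
/-- **`‖S(H,K)‖_{k+1}^{(A)} ≤ σ(r)·r` on the `r`-ball** (module docstring): the Lipschitz estimate against the
origin `(H', K') = (0, 𝟙_∅)`, where `S(0, 𝟙_∅) = 𝟙_∅` vanishes on non-empty polymers.
[cite: AdamsBuchholzKoteckyMuller2019, Theorem 6.8 / Ch. 12 (12.47)] -/
theorem weakNormLE_nextKStep_abkm_ball_of_stepKernelBounds {L N Mord R n p r₀ : ℕ} {θbar lam μ δ₁ δ₀ A𝒫 A𝒫' C₂ h A : ℝ}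
    {𝒞 : ℕ → (Fin d → ZMod M) → ℝ} (hd : 3 ≤ d) (hLodd : Odd L) (hL : 2 ^ (d + 3) + 16 * R ≤ L)
    (hR2 : 2 ≤ R) (hM : M = L ^ N) {k : ℕ} (hkN : k + 1 ≤ N)
    (hp : d / 2 + 2 ≤ p) (hpM : p + d ≤ Mord) (hMR : Mord ≤ R) (hr₀ : 3 ≤ r₀)
   
    (hB : AbkmWeightBounds L N Mord R n θbar lam μ δ₁ δ₀ A𝒫 𝒞
      (abkmWeightData L N Mord R θbar (schedDelta δ₀ δ₁ N) 𝒞))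
    (hδ₀ : 0 < δ₀) (hδ₁ : 0 < δ₁) (hh : 0 < h) (hh0 : hZeroSq d R δ₀ δ₁ ≤ h ^ 2)
   
    (hh2 : C₂ ≤ h ^ 2) (hA𝒫 : 0 ≤ A𝒫') (hA1 : 1 ≤ A)
    (hA𝒫A : A𝒫' ≤ A)
    (hsmall : (2 : ℝ) ^ (L ^ d) * (A𝒫' * A ^ (-(1 - (1 + 1 / ((2 * (2 ^ d + 1) + 6 : ℝ) ^ d))⁻¹) : ℝ)) ≤ 1)
    (D : StepData d M) (hDs : D.s = L ^ k) (hDL : D.L = L) (hS : StepKernelBounds (abkmWeightData L N Mord R θbar (schedDelta δ₀ δ₁ N) 𝒞) L k A𝒫' C₂ D.𝒞)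
    {x₀ : Fin d → ZMod M} (hB₀ : D.B₀ = blockOf (L ^ k) x₀) (hc₀ : D.c₀ = boxCorner (L ^ k) (starRad R L d k) x₀)
    {H : RelevantHamiltonian ℂ d} {r : ℝ}
    (hH : hamNorm (fieldWt h (L : ℝ) d k) ((L : ℝ) ^ k) (L ^ (d * k)) H ≤ r) (hr : r ≤ 1 / 64)
    {K : Finset (Fin d → ZMod M) → ((Fin d → ZMod M) → ℝ) → ℂ}
    (hK : WeakNormLE (abkmNormParams L N Mord R p r₀ h θbar A (schedDelta δ₀ δ₁ N) 𝒞) k K r)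
    (hKfac : Factorises (L ^ k) K) (hK0 : ∀ φ, K ∅ φ = 1)
    (hKd : ∀ Y, ContDiff ℝ r₀ (K Y))
    (hKloc : ∀ Y, IsPolymer (L ^ k) Y → IsConn Y → IsGaugeLocal ((abkmNormParams L N Mord R p r₀ h θbar A (schedDelta δ₀ δ₁ N) 𝒞).gauge k Y) (K Y))
    (hKt : TransInv (L ^ k) K)
    (hv : vABKM d R A A𝒫' r ≤ 1 / 64) (hωA : omegaABKM d R A A𝒫' r * A ^ 2 ≤ 1)
    (hc3A : (kappaABKM d R A A𝒫' r) ^ (L ^ d) * ((2 * (2 * (kappaABKM d R A A𝒫' r) * max 1 A𝒫')) ^ ((2 ^ (d + 1) + 2) ^ d * L ^ d) * (4 : ℝ) ^ ((2 ^ (d + 1) + 2) ^ d * L ^ d)) ≤ A ^ ((1 + 1 / ((2 * (2 ^ d + 1) + 6 : ℝ) ^ d)) - 1 : ℝ))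
    (hc2A : (kappaABKM d R A A𝒫' r) ^ (L ^ d) * ((2 * (kappaABKM d R A A𝒫' r) * max 1 A𝒫') ^ ((2 ^ (d + 1) + 2) ^ d * L ^ d) * (2 : ℝ) ^ ((2 ^ (d + 1) + 2) ^ d * L ^ d)) ≤ A ^ ((1 + 1 / ((2 * (2 ^ d + 1) + 6 : ℝ) ^ d)) - 1 : ℝ)) :
    WeakNormLE (abkmNormParams L N Mord R p r₀ h θbar A (schedDelta δ₀ δ₁ N) 𝒞) (k + 1) (nextKStep D H K) (sigmaABKM d L R A A𝒫' r * r) := by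
  have hL0 : (0 : ℝ) < L := by exact_mod_cast hLodd.pos
  have hA0 : 0 < A := by linarith
  have hPA : 0 < (abkmNormParams L N Mord R p r₀ h θbar A (schedDelta δ₀ δ₁ N) 𝒞).A := hA0
  have h𝔥 : 0 < fieldWt h (L : ℝ) d k := fieldWt_pos hh hL0 d k
  have hRk : (0 : ℝ) < (L : ℝ) ^ k := by positivity
  have hr0 : 0 ≤ r := (hamNorm_nonneg h𝔥.le hRk.le _ _).trans hH
  have hk1 : 1 ≤ L ^ k := Nat.one_le_pow _ _ hLodd.pos
  have hH' : hamNorm (fieldWt h (L : ℝ) d k) ((L : ℝ) ^ k) (L ^ (d * k)) (0 : RelevantHamiltonian ℂ d) ≤ r := by rw [hamNorm_zero]; exact hr0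
  have hK' : WeakNormLE (abkmNormParams L N Mord R p r₀ h θbar A (schedDelta δ₀ δ₁ N) 𝒞) k trivAct r := weakNormLE_trivAct hPA k hr0
  have hΔ : WeakNormLE (abkmNormParams L N Mord R p r₀ h θbar A (schedDelta δ₀ δ₁ N) 𝒞) k (K - trivAct) r := weakNormLE_sub_trivAct hK
  have hCΔ2 : r ≤ 2 * r := by linarith
  have h := weakNormLE_nextKStep_sub_abkm_ball_of_stepKernelBounds hd hLodd hL hR2 hM hkN hp hpM hMR hr₀ hB hδ₀ hδ₁ hh hh0
    hh2 hA𝒫 hA1 hA𝒫A hsmall D hDs hDL hS hB₀ hc₀ hH hH' hr hr0 hK hK' hΔ hCΔ2 hKfac hK0 (factorises_trivAct hk1)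
    (fun φ => by rw [trivAct_apply, TorusPolymer.punit_empty]) hKd (contDiff_trivAct r₀) hKloc
    (fun Y _ _ => isGaugeLocal_trivAct _ Y) hKt (transInv_trivAct (L ^ k)) hv hωA hc3A hc2A
  have hB0ne : D.B₀ ≠ ∅ := by rw [hB₀]; exact Finset.ne_empty_of_mem (mem_blockOf_self (L ^ k) x₀)
  intro U hU hUc
  have hUne : U ≠ ∅ := Finset.nonempty_iff_ne_empty.1 hUc.1
  have hfun : (fun φ => nextKStep D H K U φ - nextKStep D 0 trivAct U φ) = nextKStep D H K U := by
    funext φ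
    rw [nextKStep_zero_trivAct D hB0ne U φ]
    unfold TorusPolymer.punit
    rw [if_neg hUne, sub_zero]
  have hU := h U hU hUc
  dsimp only at hU
  rw [hfun, sub_zero, max_eq_right hH] at hU
  exact hU

set_option maxHeartbeats 400000 in
/-- **`S(H,K)(U, ·) ∈ C^{r₀}` for every `U`** (module docstring).
[cite: AdamsBuchholzKoteckyMuller2019, Theorem 6.8 (smoothness of S_k), Lemma 9.6] -/
theorem contDiff_nextKStep_abkm_of_stepKernelBounds {L N Mord R n p r₀ : ℕ} {θbar lam μ δ₁ δ₀ A𝒫 A𝒫' C₂ h A : ℝ}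
    {𝒞 : ℕ → (Fin d → ZMod M) → ℝ} (hd : 3 ≤ d) (hLodd : Odd L) (hL : 2 ^ (d + 3) + 16 * R ≤ L)
    (hM : M = L ^ N) {k : ℕ} (hkN : k + 1 ≤ N) (hp : d / 2 + 2 ≤ p) (hpM : p + d ≤ Mord) (hMR : Mord ≤ R)
   
    (hB : AbkmWeightBounds L N Mord R n θbar lam μ δ₁ δ₀ A𝒫 𝒞
      (abkmWeightData L N Mord R θbar (schedDelta δ₀ δ₁ N) 𝒞))
    (hδ₀ : 0 < δ₀) (hδ₁ : 0 < δ₁) (hh : 0 < h) (hh0 : hZeroSq d R δ₀ δ₁ ≤ h ^ 2) (hA1 : 1 ≤ A)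
    (D : StepData d M) (hDs : D.s = L ^ k) (hDL : D.L = L) (hS : StepKernelBounds (abkmWeightData L N Mord R θbar (schedDelta δ₀ δ₁ N) 𝒞) L k A𝒫' C₂ D.𝒞)
    {x₀ : Fin d → ZMod M} (hB₀ : D.B₀ = blockOf (L ^ k) x₀) (hc₀ : D.c₀ = boxCorner (L ^ k) (starRad R L d k) x₀)
    {H : RelevantHamiltonian ℂ d} (hH : hamNorm (fieldWt h (L : ℝ) d k) ((L : ℝ) ^ k) (L ^ (d * k)) H ≤ 1 / 8)
    {K : Finset (Fin d → ZMod M) → ((Fin d → ZMod M) → ℝ) → ℂ} {C : ℝ} (hC : 0 ≤ C)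
    (hK : WeakNormLE (abkmNormParams L N Mord R p r₀ h θbar A (schedDelta δ₀ δ₁ N) 𝒞) k K C)
    (hKfac : Factorises (L ^ k) K) (hK0 : ∀ φ, K ∅ φ = 1) (hKd : ∀ Y, ContDiff ℝ r₀ (K Y))
    (hKloc : ∀ Y, IsPolymer (L ^ k) Y → IsConn Y → IsGaugeLocal ((abkmNormParams L N Mord R p r₀ h θbar A (schedDelta δ₀ δ₁ N) 𝒞).gauge k Y) (K Y))
    (U : Finset (Fin d → ZMod M)) : ContDiff ℝ r₀ (nextKStep D H K U) := by
  by_cases hUe : U = ∅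
  · subst hUe
    have : nextKStep D H K ∅ = fun _ => (1 : ℂ) := funext (nextKStep_empty D H hK0)
    rw [this]; exact contDiff_const
  have hUne : U.Nonempty := Finset.nonempty_iff_ne_empty.2 hUe
  have hd2 : 2 ≤ d := by omega
  have hp1 : d / 2 + 1 ≤ p := by omega
  have hpR : p ≤ R := by omega
  have hMord : d / 2 + 1 ≤ Mord := by omega
  have hA0 : 0 < A := by linarith
  have hk1 : k + 1 ≤ N + 1 := by omega
  have hUk : ∀ X ∈ ((polys (L ^ k) univ).filter (fun X => reblock (L ^ k) (L * L ^ k) X = U)), IsPolymer (L ^ k) X :=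
    fun X hX => (mem_polys.1 (mem_filter.1 hX).1).2
  have hblk : ∀ B ∈ blockPartIndex D U, ∃ y, B = blockOf (L ^ k) y := fun B hB' => by
    have hBb := blockPartIndex_subset_blocks D U hB'
    rw [hDs] at hBb
    obtain ⟨y, -, rfl⟩ := mem_blocks.1 hBb
    exact ⟨y, rfl⟩
  have hF0d : ContDiff ℝ r₀ (fun φ => blockPart D K U φ) :=
    contDiff_blockPart_abkm_of_stepKernelBounds hB hLodd hM hA0 D hDs hS hC hK hKd hKloc U
  have hF1d : ContDiff ℝ r₀ (fun φ => ∑ B ∈ blockPartIndex D U,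
        ((bprod (L ^ k) (fun B' => expNegH (nextH D H K) B' φ) (U \ B) *
              bprod (L ^ k) (fun B' => expNegH (-(nextH D H K)) B' φ) (B \ U) - 1) * blockTerm D K B φ +
          bprod (L ^ k) (fun B' => expNegH (nextH D H K) B' φ) (U \ B) *
              bprod (L ^ k) (fun B' => expNegH (-(nextH D H K)) B' φ) (B \ U) *
            (fluctDefect D.𝒞 H B φ +
              (expNegH (stepOpA (gradCov D.𝒞) H) B φ - 1) * (1 - Complex.exp (-(eval (opB D K) B φ))) -
              (Complex.exp (-(eval (opB D K) B φ)) - 1 + eval (opB D K) B φ)) +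
          bprod (L ^ k) (fun B' => expNegH (nextH D H K) B' φ) (U \ B) *
              bprod (L ^ k) (fun B' => expNegH (-(nextH D H K)) B' φ) (B \ U) *
            fluct D.𝒞 (fun ψ => ∑ Y ∈ ((polys (L ^ k) B).erase B).erase ∅,
              bprod (L ^ k) (fun B' => expNegH H B' ψ - 1) (B \ Y) * K Y ψ) φ)) := by
    refine ContDiff.sum fun B hB' => ?_
    obtain ⟨y, rfl⟩ := hblk B hB'
    exact contDiff_blockSummand_abkm_of_stepKernelBounds (p := p) (r₀ := r₀) (A := A) hd2 hB hLodd hM hkN hδ₀ hδ₁ hh hh0 hMord hp1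
      hA0 D hS y (nextH D H K) hH hC hK hKd hKloc U
  have hF2d : ContDiff ℝ r₀ (fun φ => ∑ X ∈ largePartIndex (L ^ k) L U,
        bprod (L ^ k) (fun B => expNegH (nextH D H K) B φ) (U \ X) *
            bprod (L ^ k) (fun B => expNegH (-(nextH D H K)) B φ) (X \ U) *
          (fluct D.𝒞 (polyP2 (L ^ k) H K X) φ + bprod (L ^ k) (fun B => 1 - expNegH (nextH D H K) B φ) X)) := by
    refine ContDiff.sum fun X hX => ?_
    obtain ⟨hXp, -, -, -⟩ := mem_largePartIndex.1 hX
    exact contDiff_reblockTop_abkm_of_stepKernelBounds hd2 hLodd hM hkN hS hp1 hMord hB hδ₀ hδ₁ hh hh0 hA0 hXp (nextH D H K) hH hC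
      hK hKfac hK0 hKd hKloc U
  have hF3d : ContDiff ℝ r₀ (fun φ => ∑ X ∈ ((polys (L ^ k) univ).filter (fun X => reblock (L ^ k) (L * L ^ k) X = U)).filter
          (fun X => ¬ IsConn X),
        bprod (L ^ k) (fun B => expNegH (nextH D H K) B φ) (U \ X) *
            bprod (L ^ k) (fun B => expNegH (-(nextH D H K)) B φ) (X \ U) *
          (fluct D.𝒞 (polyP2 (L ^ k) H K X) φ + bprod (L ^ k) (fun B => 1 - expNegH (nextH D H K) B φ) X)) := by
    refine ContDiff.sum fun X hX => ?_
    have hXp := hUk X (mem_filter.1 hX).1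
    exact contDiff_reblockTop_abkm_of_stepKernelBounds hd2 hLodd hM hkN hS hp1 hMord hB hδ₀ hδ₁ hh hh0 hA0 hXp (nextH D H K) hH hC
      hK hKfac hK0 hKd hKloc U
  have hF4d : ContDiff ℝ r₀ (fun φ => ∑ X ∈ (polys (L ^ k) univ).filter (fun X => reblock (L ^ k) (L * L ^ k) X = U),
        ∑ X₁ ∈ ((polys (L ^ k) X).erase X).erase ∅,
          bprod (L ^ k) (fun B => expNegH (nextH D H K) B φ) (U \ X) *
            bprod (L ^ k) (fun B => expNegH (-(nextH D H K)) B φ) (X \ U) *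
            (bprod (L ^ k) (fun B => 1 - expNegH (nextH D H K) B φ) X₁ *
              fluct D.𝒞 (polyP2 (L ^ k) H K (X \ X₁)) φ)) := by
    refine ContDiff.sum fun X hX => ContDiff.sum fun X₁ hX₁ => ?_
    have hXp := hUk X hX
    have hX₁p : X₁ ∈ polys (L ^ k) X := mem_of_mem_erase (mem_of_mem_erase hX₁)
    exact contDiff_reblockSub_abkm_of_stepKernelBounds hd2 hLodd hM hkN hS hp1 hMord hB hδ₀ hδ₁ hh hh0 hA0 hXp hX₁p (nextH D H K) hH
      hC hK hKfac hK0 hKd hKloc U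
  have hdec := nextKStep_eq_blockPart_add_remainders_abkm_of_stepKernelBounds (p := p) (r₀ := r₀) (A := A) hd2 hLodd hL hM hkN hp1 hpR hMord hB hδ₀ hδ₁ hh hh0 hA0 D hDs hDL hS hB₀ hc₀ hH hC hK hKfac hK0 hKd hKloc hUne
  have hfun : nextKStep D H K U = (fun φ => blockPart D K U φ) + (fun φ => ∑ B ∈ blockPartIndex D U,
        ((bprod (L ^ k) (fun B' => expNegH (nextH D H K) B' φ) (U \ B) *
              bprod (L ^ k) (fun B' => expNegH (-(nextH D H K)) B' φ) (B \ U) - 1) * blockTerm D K B φ +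
          bprod (L ^ k) (fun B' => expNegH (nextH D H K) B' φ) (U \ B) *
              bprod (L ^ k) (fun B' => expNegH (-(nextH D H K)) B' φ) (B \ U) *
            (fluctDefect D.𝒞 H B φ +
              (expNegH (stepOpA (gradCov D.𝒞) H) B φ - 1) * (1 - Complex.exp (-(eval (opB D K) B φ))) -
              (Complex.exp (-(eval (opB D K) B φ)) - 1 + eval (opB D K) B φ)) +
          bprod (L ^ k) (fun B' => expNegH (nextH D H K) B' φ) (U \ B) *
              bprod (L ^ k) (fun B' => expNegH (-(nextH D H K)) B' φ) (B \ U) *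
            fluct D.𝒞 (fun ψ => ∑ Y ∈ ((polys (L ^ k) B).erase B).erase ∅,
              bprod (L ^ k) (fun B' => expNegH H B' ψ - 1) (B \ Y) * K Y ψ) φ)) + (fun φ => ∑ X ∈ largePartIndex (L ^ k) L U,
        bprod (L ^ k) (fun B => expNegH (nextH D H K) B φ) (U \ X) *
            bprod (L ^ k) (fun B => expNegH (-(nextH D H K)) B φ) (X \ U) *
          (fluct D.𝒞 (polyP2 (L ^ k) H K X) φ + bprod (L ^ k) (fun B => 1 - expNegH (nextH D H K) B φ) X)) + (fun φ => ∑ X ∈ ((polys (L ^ k) univ).filter (fun X => reblock (L ^ k) (L * L ^ k) X = U)).filter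
          (fun X => ¬ IsConn X),
        bprod (L ^ k) (fun B => expNegH (nextH D H K) B φ) (U \ X) *
            bprod (L ^ k) (fun B => expNegH (-(nextH D H K)) B φ) (X \ U) *
          (fluct D.𝒞 (polyP2 (L ^ k) H K X) φ + bprod (L ^ k) (fun B => 1 - expNegH (nextH D H K) B φ) X)) + (fun φ => ∑ X ∈ (polys (L ^ k) univ).filter (fun X => reblock (L ^ k) (L * L ^ k) X = U),
        ∑ X₁ ∈ ((polys (L ^ k) X).erase X).erase ∅,
          bprod (L ^ k) (fun B => expNegH (nextH D H K) B φ) (U \ X) *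
            bprod (L ^ k) (fun B => expNegH (-(nextH D H K)) B φ) (X \ U) *
            (bprod (L ^ k) (fun B => 1 - expNegH (nextH D H K) B φ) X₁ *
              fluct D.𝒞 (polyP2 (L ^ k) H K (X \ X₁)) φ)) := by
    funext ψ
    simp only [Pi.add_apply]
    exact hdec ψ
  rw [hfun]
  exact (((hF0d.add hF1d).add hF2d).add hF3d).add hF4d

/-- **Lemma 6.4 (1), torus data**: `S(H,K)` is translation invariant on scale `k+1` when `K` is on
scale `k`. [cite: AdamsBuchholzKoteckyMuller2019, Lemma 6.4 (1)] -/
theorem transInv_nextKStep_abkm_of_stepKernelBounds {L N Mord R : ℕ} {θbar δ₁ δ₀ A𝒫' C₂ : ℝ}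
    {𝒞 : ℕ → (Fin d → ZMod M) → ℝ} (hLodd : Odd L) (hL : 2 ^ (d + 3) + 16 * R ≤ L)
    (hM : M = L ^ N) {k : ℕ} (hkN : k + 1 ≤ N)
    (D : StepData d M) (hDs : D.s = L ^ k) (hDL : D.L = L) (hS : StepKernelBounds (abkmWeightData L N Mord R θbar (schedDelta δ₀ δ₁ N) 𝒞) L k A𝒫' C₂ D.𝒞)
    (H : RelevantHamiltonian ℂ d) {K : Finset (Fin d → ZMod M) → ((Fin d → ZMod M) → ℝ) → ℂ}
    (hKt : TransInv (L ^ k) K) : TransInv (L ^ (k + 1)) (nextKStep D H K) := by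
  have h8 : 8 ≤ 2 ^ (d + 3) := by
    calc 8 = 2 ^ 3 := by norm_num
      _ ≤ 2 ^ (d + 3) := Nat.pow_le_pow_right (by norm_num) (by omega)
  have h2d : 2 ^ d ≤ L := by
    have : 2 ^ d ≤ 2 ^ (d + 3) := Nat.pow_le_pow_right (by norm_num) (by omega)
    omega
  have hMst : M = (D.L * D.s) * L ^ (N - (k + 1)) := by
    rw [hDL, hDs, ← pow_succ', ← pow_add, Nat.add_sub_cancel' (show k + 1 ≤ N from hkN)]; exact hM
  have hL2 : 2 ^ d * D.s ≤ D.L * D.s := by rw [hDL]; exact Nat.mul_le_mul_right _ h2d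
  have hC : (Matrix.circulant D.𝒞).PosSemidef := by exact hS.posSemidef
  have hs : Odd D.s := by rw [hDs]; exact hLodd.pow
  have hL' : Odd D.L := by rw [hDL]; exact hLodd
  have hK' : TransInv D.s K := by rw [hDs]; exact hKt
  have h := transInv_nextKStep D hMst hs hL' hLodd.pow hL2 hC H hK'
  rw [hDL, hDs, ← pow_succ'] at h
  exact h

set_option maxHeartbeats 400000 in
/-- **`restrictConn (L^{k+1}) (S(H,K)) ∈ activitySpace P (k+1)` on the `r`-ball** (module docstring).
[cite: AdamsBuchholzKoteckyMuller2019, Theorem 6.8 / Ch. 12 (12.2)] -/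
theorem restrictConn_nextKStep_mem_activitySpace_of_stepKernelBounds {L N Mord R n p r₀ : ℕ} {θbar lam μ δ₁ δ₀ A𝒫 A𝒫' C₂ h A : ℝ}
    {𝒞 : ℕ → (Fin d → ZMod M) → ℝ} (hd : 3 ≤ d) (hLodd : Odd L) (hL : 2 ^ (d + 3) + 16 * R ≤ L)
    (hR2 : 2 ≤ R) (hM : M = L ^ N) {k : ℕ} (hkN : k + 1 ≤ N)
    (hp : d / 2 + 2 ≤ p) (hpM : p + d ≤ Mord) (hMR : Mord ≤ R) (hr₀ : 3 ≤ r₀)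
   
    (hB : AbkmWeightBounds L N Mord R n θbar lam μ δ₁ δ₀ A𝒫 𝒞
      (abkmWeightData L N Mord R θbar (schedDelta δ₀ δ₁ N) 𝒞))
    (hδ₀ : 0 < δ₀) (hδ₁ : 0 < δ₁) (hh : 0 < h) (hh0 : hZeroSq d R δ₀ δ₁ ≤ h ^ 2)
   
    (hh2 : C₂ ≤ h ^ 2) (hA𝒫 : 0 ≤ A𝒫') (hA1 : 1 ≤ A)
    (hA𝒫A : A𝒫' ≤ A)
    (hsmall : (2 : ℝ) ^ (L ^ d) * (A𝒫' * A ^ (-(1 - (1 + 1 / ((2 * (2 ^ d + 1) + 6 : ℝ) ^ d))⁻¹) : ℝ)) ≤ 1)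
    (D : StepData d M) (hDs : D.s = L ^ k) (hDL : D.L = L) (hS : StepKernelBounds (abkmWeightData L N Mord R θbar (schedDelta δ₀ δ₁ N) 𝒞) L k A𝒫' C₂ D.𝒞)
    {x₀ : Fin d → ZMod M} (hB₀ : D.B₀ = blockOf (L ^ k) x₀) (hc₀ : D.c₀ = boxCorner (L ^ k) (starRad R L d k) x₀)
    {H : RelevantHamiltonian ℂ d} {r : ℝ}
    (hH : hamNorm (fieldWt h (L : ℝ) d k) ((L : ℝ) ^ k) (L ^ (d * k)) H ≤ r) (hr : r ≤ 1 / 64)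
    {K : Finset (Fin d → ZMod M) → ((Fin d → ZMod M) → ℝ) → ℂ}
    (hK : WeakNormLE (abkmNormParams L N Mord R p r₀ h θbar A (schedDelta δ₀ δ₁ N) 𝒞) k K r)
    (hKfac : Factorises (L ^ k) K) (hK0 : ∀ φ, K ∅ φ = 1)
    (hKd : ∀ Y, ContDiff ℝ r₀ (K Y))
    (hKloc : ∀ Y, IsPolymer (L ^ k) Y → IsConn Y → IsGaugeLocal ((abkmNormParams L N Mord R p r₀ h θbar A (schedDelta δ₀ δ₁ N) 𝒞).gauge k Y) (K Y))
    (hKt : TransInv (L ^ k) K)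
    (hv : vABKM d R A A𝒫' r ≤ 1 / 64) (hωA : omegaABKM d R A A𝒫' r * A ^ 2 ≤ 1)
    (hc3A : (kappaABKM d R A A𝒫' r) ^ (L ^ d) * ((2 * (2 * (kappaABKM d R A A𝒫' r) * max 1 A𝒫')) ^ ((2 ^ (d + 1) + 2) ^ d * L ^ d) * (4 : ℝ) ^ ((2 ^ (d + 1) + 2) ^ d * L ^ d)) ≤ A ^ ((1 + 1 / ((2 * (2 ^ d + 1) + 6 : ℝ) ^ d)) - 1 : ℝ))
    (hc2A : (kappaABKM d R A A𝒫' r) ^ (L ^ d) * ((2 * (kappaABKM d R A A𝒫' r) * max 1 A𝒫') ^ ((2 ^ (d + 1) + 2) ^ d * L ^ d) * (2 : ℝ) ^ ((2 ^ (d + 1) + 2) ^ d * L ^ d)) ≤ A ^ ((1 + 1 / ((2 * (2 ^ d + 1) + 6 : ℝ) ^ d)) - 1 : ℝ)) :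
    restrictConn (L ^ (k + 1)) (nextKStep D H K) ∈ activitySpace (abkmNormParams L N Mord R p r₀ h θbar A (schedDelta δ₀ δ₁ N) 𝒞) (k + 1) := by
  have hL0 : (0 : ℝ) < L := by exact_mod_cast hLodd.pos
  have h𝔥 : 0 < fieldWt h (L : ℝ) d k := fieldWt_pos hh hL0 d k
  have hRk : (0 : ℝ) < (L : ℝ) ^ k := by positivity
  have hr0 : 0 ≤ r := (hamNorm_nonneg h𝔥.le hRk.le _ _).trans hH
  have hH8 : hamNorm (fieldWt h (L : ℝ) d k) ((L : ℝ) ^ k) (L ^ (d * k)) H ≤ 1 / 8 := by linarith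
  obtain ⟨t, ht⟩ : ∃ t, N = (k + 1) + t := ⟨N - (k + 1), by omega⟩
  have hMt : M = (abkmNormParams L N Mord R p r₀ h θbar A (schedDelta δ₀ δ₁ N) 𝒞).L ^ (k + 1) * L ^ t := by
    show M = L ^ (k + 1) * L ^ t
    rw [← pow_add, ← ht]; exact hM
  have hbound := weakNormLE_nextKStep_abkm_ball_of_stepKernelBounds hd hLodd hL hR2 hM hkN hp hpM hMR hr₀ hB hδ₀ hδ₁ hh hh0
    hh2 hA𝒫 hA1 hA𝒫A hsmall D hDs hDL hS hB₀ hc₀ hH hr hK hKfac hK0 hKd hKloc hKt hv hωA hc3A hc2A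
  exact restrictConn_mem_activitySpace hMt hLodd.pow hLodd.pow
    (fun U _ _ => contDiff_nextKStep_abkm_of_stepKernelBounds hd hLodd hL hM hkN hp hpM hMR hB hδ₀ hδ₁ hh hh0 hA1 D hDs hDL hS
      hB₀ hc₀ hH8 hr0 hK hKfac hK0 hKd hKloc U)
    (fun U _ _ => isGaugeLocal_nextKStep_abkm hd hLodd hL hM hkN hp hh D hDs hDL H hKfac hK0 hKloc U)
    (transInv_nextKStep_abkm_of_stepKernelBounds hLodd hL hM hkN D hDs hDL hS H hKt) hbound

end Literature.MathematicalPhysics.StatisticalMechanics.GradientRG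

end
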